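import Literature.GroupTheory.CombinatorialGroupTheory.RandomSclFreeGroupBigCorners
import Mathlib.GroupTheory.Perm.Cycle.Factors
import HarnessLib

/-!
# Random rigidity of scl (Calegari–Walker 2013): proofs, part 32 — orbit data for the fan
resolution (apex, index, size)

D. Calegari, A. Walker, *Random rigidity in the free group*, Geom. Topol. 17 (2013)
[CalegariWalker2013], §4.4 ("we artificially split open vertices of higher valence so that `Y` is
trivalent"). A vertex of the fatgraph of a pairing is an orbit of the vertex permutation `τ`;
to resolve it by a fan of triangles we fix in every orbit an *apex* (chosen outside a given set
of bad corners whenever possible), and index the corners of the orbit `q_i = τ^i (apex)`,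
`0 ≤ i < r`. This file packages the choice: functions `apex`, `ind`, `rr` on corners with their
defining properties.

* **`exists_orbit_data`** — apex, index and orbit size, for a fixed-point-free permutation.
-/

noncomputable section

namespace Literature.GroupTheory.CombinatorialGroupTheory

section OrbitData

open Equiv Finset

open scoped Classical

set_option maxHeartbeats 800000 in
/-- **Orbit data.** For a permutation `τ` of `Fin N` without fixed points and a set `Bad` of
corners there are functions `apex`, `ind`, `rr` such that for every big corner `x`
(`τ² x ≠ x`): `rr x ≥ 3` is the size of the orbit of `x`; `apex x` lies in the orbit, depends
only on the orbit, and is bad only if the whole orbit is bad; `x = τ^{ind x} (apex x)` with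
`ind x < rr x`; powers of `τ` at the apex are periodic exactly modulo `rr x`; and the corners
`τ^i (apex x)` are big, with the same apex and size, and index `i mod rr x`. [folklore] -/
theorem exists_orbit_data {N : ℕ} (τ : Equiv.Perm (Fin N)) (hτ : ∀ x, τ x ≠ x)
    (Bad : Finset (Fin N)) :
    ∃ (apex : Fin N → Fin N) (ind rr : Fin N → ℕ),
      (∀ x, τ (τ x) ≠ x → 3 ≤ rr x) ∧
      (∀ x, τ (τ x) ≠ x → ind x < rr x ∧ (τ ^ (ind x)) (apex x) = x) ∧
      (∀ x, τ (τ x) ≠ x → ∀ m n : ℕ, (τ ^ m) (apex x) = (τ ^ n) (apex x) ↔ m % rr x = n % rr x) ∧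
      (∀ x, τ (τ x) ≠ x → ∀ i : ℕ, apex ((τ ^ i) (apex x)) = apex x ∧ rr ((τ ^ i) (apex x)) = rr x ∧
        τ (τ ((τ ^ i) (apex x))) ≠ (τ ^ i) (apex x) ∧ ind ((τ ^ i) (apex x)) = i % rr x) ∧
      (∀ x, τ (τ x) ≠ x → apex x ∈ Bad → ∀ i : ℕ, (τ ^ i) (apex x) ∈ Bad) ∧
      (∀ x, τ (τ x) ≠ x → apex (τ x) = apex x ∧ rr (τ x) = rr x ∧ ind (τ x) = (ind x + 1) % rr x) := by
  -- the orbit of `x` as a finset, and its size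
  set O : Fin N → Finset (Fin N) := fun x => (τ.cycleOf x).support with hO
  set rr : Fin N → ℕ := fun x => (O x).card with hrr
  have hmemO : ∀ x y, y ∈ O x ↔ τ.SameCycle x y := by
    intro x y
    simp only [hO]
    rw [Equiv.Perm.mem_support_cycleOf_iff]
    constructor
    · exact fun h => h.1
    · exact fun h => ⟨h, Equiv.Perm.mem_support.mpr (hτ x)⟩
  have hOeq : ∀ x y, τ.SameCycle x y → O x = O y := by
    intro x y h; simp only [hO]; rw [h.cycleOf_eq]
  have hxO : ∀ x, x ∈ O x := fun x => (hmemO x x).mpr (Equiv.Perm.SameCycle.refl _ _)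
  have hOne : ∀ x, (O x).Nonempty := fun x => ⟨x, hxO x⟩
  -- the apex, as a function of the orbit finset (with an irrelevant default)
  set apexOf : Finset (Fin N) → Fin N → Fin N := fun O' dflt =>
    if h : (O'.filter fun y => y ∉ Bad).Nonempty then (O'.filter fun y => y ∉ Bad).min' h
    else if h' : O'.Nonempty then O'.min' h' else dflt with hapexOf
  have hapexOf_irrel : ∀ (O' : Finset (Fin N)) (d d' : Fin N), O'.Nonempty → apexOf O' d = apexOf O' d' := by
    intro O' d d' hne
    simp only [hapexOf, dif_pos hne]
  set apex : Fin N → Fin N := fun x => apexOf (O x) x with hapex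
  have hapexO : ∀ x, apex x ∈ O x := by
    intro x
    simp only [hapex, hapexOf]
    split_ifs with h h'
    · exact (Finset.mem_filter.mp (Finset.min'_mem _ h)).1
    · exact Finset.min'_mem _ _
    · exact absurd (hOne x) h'
  have hapex_eq : ∀ x y, τ.SameCycle x y → apex x = apex y := by
    intro x y h
    simp only [hapex]
    rw [hOeq x y h]
    exact hapexOf_irrel _ _ _ (hOne y)
  have hapex_bad : ∀ x, apex x ∈ Bad → ∀ y, y ∈ O x → y ∈ Bad := by
    intro x hx y hy
    by_contra hyb
    have hne : ((O x).filter fun y => y ∉ Bad).Nonempty := ⟨y, Finset.mem_filter.mpr ⟨hy, hyb⟩⟩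
    have : apex x = ((O x).filter fun y => y ∉ Bad).min' hne := by
      simp only [hapex, hapexOf]; rw [dif_pos hne]
    have hmem := Finset.min'_mem _ hne
    rw [← this, Finset.mem_filter] at hmem
    exact hmem.2 hx
  -- periodicity at the apex: `τ` is a cycle on `O x`
  have hcycOn : ∀ x, τ.IsCycleOn ((O x : Finset (Fin N)) : Set (Fin N)) := by
    intro x; simp only [hO]; exact Equiv.Perm.isCycleOn_support_cycleOf τ x
  have hperiod : ∀ x, ∀ m n : ℕ, (τ ^ m) (apex x) = (τ ^ n) (apex x) ↔ m ≡ n [MOD rr x] := by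
    intro x m n
    exact (hcycOn x).pow_apply_eq_pow_apply (hapexO x)
  -- the index
  have hex : ∀ x, ∃ k : ℕ, (τ ^ k) (apex x) = x := by
    intro x
    have h : τ.SameCycle (apex x) x := ((hmemO x _).mp (hapexO x)).symm
    obtain ⟨i, _, hi⟩ := h.exists_pow_eq'
    exact ⟨i, hi⟩
  have hrrpos : ∀ x, 0 < rr x := fun x => Finset.card_pos.mpr (hOne x)
  set ind : Fin N → ℕ := fun x => Nat.find (hex x) % rr x with hind
  have hind_spec : ∀ x, (τ ^ (ind x)) (apex x) = x := by
    intro x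
    have h := Nat.find_spec (hex x)
    simp only [hind]
    conv_rhs => rw [← h]
    rw [hperiod]
    exact Nat.mod_modEq _ _
  have hind_lt : ∀ x, ind x < rr x := fun x => Nat.mod_lt _ (hrrpos x)
  -- membership of powers in the orbit
  have hpowO : ∀ x (i : ℕ), (τ ^ i) (apex x) ∈ O x := by
    intro x i
    rw [hmemO]
    have h1 : τ.SameCycle x (apex x) := (hmemO x _).mp (hapexO x)
    exact h1.trans ⟨i, rfl⟩
  have hsame : ∀ x (i : ℕ), τ.SameCycle x ((τ ^ i) (apex x)) := fun x i => (hmemO x _).mp (hpowO x i)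
  -- bigness along orbits
  have hcomm : ∀ (k : ℤ) (w : Fin N), τ ((τ ^ k) w) = (τ ^ k) (τ w) := by
    intro k w
    rw [← Equiv.Perm.mul_apply, ← Equiv.Perm.mul_apply, ← zpow_one_add, add_comm, zpow_add_one]
  have hbig_iff : ∀ x y, τ.SameCycle x y → (τ (τ x) ≠ x ↔ τ (τ y) ≠ y) := by
    intro x y ⟨k, hk⟩
    rw [← hk, hcomm, hcomm]
    exact ((τ ^ k).injective.ne_iff).symm
  -- size ≥ 3 for big orbits
  have hrr3 : ∀ x, τ (τ x) ≠ x → 3 ≤ rr x := by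
    intro x hx
    have h1 : x ∈ O x := hxO x
    have h2 : τ x ∈ O x := (hmemO x _).mpr ⟨1, by rw [zpow_one]⟩
    have h3 : τ (τ x) ∈ O x := (hmemO x _).mpr ⟨2, by
      rw [show (2 : ℤ) = 1 + 1 by norm_num, zpow_add, zpow_one, Equiv.Perm.mul_apply]⟩
    have hne1 : τ x ≠ x := hτ x
    have hne2 : τ (τ x) ≠ τ x := fun h => hτ x (τ.injective h)
    have hlt : 2 < (O x).card := by
      rw [Finset.two_lt_card_iff]
      exact ⟨x, τ x, τ (τ x), h1, h2, h3, hne1.symm, hx.symm, hne2.symm⟩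
    exact hlt
  refine ⟨apex, ind, rr, hrr3, fun x _ => ⟨hind_lt x, hind_spec x⟩, ?_, ?_, ?_, ?_⟩
  · intro x _ m n
    rw [hperiod]
    exact Iff.rfl
  · intro x hx i
    have hs := hsame x i
    refine ⟨(hapex_eq _ _ hs).symm, ?_, (hbig_iff _ _ hs).mp hx, ?_⟩
    · simp only [hrr]; rw [hOeq _ _ hs]
    · -- the index of `τ^i (apex x)` is `i % rr x`
      have h1 := hind_spec ((τ ^ i) (apex x))
      rw [← hapex_eq _ _ hs] at h1
      rw [hperiod] at h1
      have h2 : rr ((τ ^ i) (apex x)) = rr x := by simp only [hrr]; rw [hOeq _ _ hs]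
      rw [Nat.ModEq, Nat.mod_eq_of_lt (by rw [← h2]; exact hind_lt _)] at h1
      exact h1
  · intro x _ hbad i
    exact hapex_bad x hbad _ (hpowO x i)
  · intro x hx
    have hs : τ.SameCycle x (τ x) := ⟨1, by simp⟩
    refine ⟨(hapex_eq _ _ hs).symm, by simp only [hrr]; rw [hOeq _ _ hs], ?_⟩
    -- `τ x = τ^{ind x + 1} (apex x)`
    have h1 : τ x = (τ ^ (ind x + 1)) (apex x) := by
      rw [pow_succ', Equiv.Perm.mul_apply, hind_spec]
    have h2 := hind_spec (τ x)
    rw [← hapex_eq _ _ hs] at h2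
    conv_rhs at h2 => rw [h1]
    rw [hperiod] at h2
    have h3 : rr (τ x) = rr x := by simp only [hrr]; rw [hOeq _ _ hs]
    rw [Nat.ModEq, Nat.mod_eq_of_lt (by rw [← h3]; exact hind_lt _)] at h2
    exact h2

end OrbitData

end Literature.GroupTheory.CombinatorialGroupTheory

end
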